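import Summits.ValiantsHypothesis.ValiantsHypothesis.Theses.StatementJunkGuard

/-!
# Junk guard for `complexity` — discharge of `ArithCircuit.exists_computes` (+ companions)

Proves the route decl `StatementJunkGuard.ArithCircuitExistsComputesProved`
(item stmt-ValiantsHypothesis-0546): every `MvPolynomial` is computed by a well-formed
fan-in-two arithmetic circuit (sum of monomials, by `MvPolynomial.induction_on` with the
`ArithCircuit.add`/`mul` combinators). Companions discharged on the way (all in-tree
`def … : Prop` facts of `Literature/Computability/AlgebraicComplexity/{ArithCircuit,ValiantClasses}.lean`):
`gateValues_append`, `eval_add`, `eval_mul`, `eval_rename`, `complexity_rename_le`,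
`IsVPFamily.isVNPFamily`, `VP_subset_VNP`; plus `complexity_attained` (the `sInf` defining
`complexity f` is a minimum) and `valiantsHypothesis_iff_not_subset : ValiantsHypothesis ↔ ¬ VNP ℂ ⊆ VP ℂ`.
Written by refuter-audit-ValiantsHypothesis-g2-0 (audit mode: NOT proposed; for a prover /
the operator to land). [folklore] [cite: Burgisser2000, §2.1]
-/

noncomputable section


open MvPolynomial

namespace Literature.CplxAlg

section ArithCircuit
open Literature.Computability.AlgebraicComplexity (ArithCircuit)
open Literature.Computability.AlgebraicComplexity.ArithCircuit

universe u v

variable {k : Type u} {σ : Type v}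

/-- Shifting does not change the fan-in. -/
theorem _root_.Literature.Computability.AlgebraicComplexity.ArithCircuit.Gate.fanIn_shift (n : ℕ) (g : Gate k σ) : (g.shift n).fanIn = g.fanIn := by
  cases g <;> simp [Gate.shift, Gate.fanIn, Gate.args]

variable [CommSemiring k]

/-- A shifted gate evaluated against `pre ++ vals` (shift = `pre.length`) reads `vals`. -/
theorem _root_.Literature.Computability.AlgebraicComplexity.ArithCircuit.Gate.eval_shift_append (pre vals : List (MvPolynomial σ k)) (g : Gate k σ) :
    (g.shift pre.length).eval (pre ++ vals) = g.eval vals := by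
  cases g with
  | sum args =>
    simp [Gate.shift, Gate.eval, List.map_map, Function.comp_def, Operand.eval_shift_append]
  | prod args =>
    simp [Gate.shift, Gate.eval, List.map_map, Function.comp_def, Operand.eval_shift_append]

/-- The left fold over shifted gates with a prefix of values. -/
theorem _root_.Literature.Computability.AlgebraicComplexity.ArithCircuit.foldl_shift (pre : List (MvPolynomial σ k)) (gs : List (Gate k σ))
    (vals : List (MvPolynomial σ k)) :
    (gs.map (Gate.shift pre.length)).foldl (fun vals g => vals ++ [g.eval vals]) (pre ++ vals)
      = pre ++ gs.foldl (fun vals g => vals ++ [g.eval vals]) vals := by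
  induction gs generalizing vals with
  | nil => simp
  | cons g rest ih =>
    simp only [List.map_cons, List.foldl_cons]
    rw [Gate.eval_shift_append, List.append_assoc, ih]

/-- Discharge of the in-tree fact `ArithCircuit.gateValues_append`. -/
theorem _root_.Literature.Computability.AlgebraicComplexity.ArithCircuit.gateValues_append_holds : @gateValues_append k σ _ := by
  intro P Q
  show gateValues (P.gates ++ Q.gates.map (Gate.shift P.size)) = _
  have hP : P.size = (gateValues P.gates).length := (gateValues_length (k := k) P.gates).symm
  unfold gateValues
  rw [List.foldl_append, hP]
  have := foldl_shift (k := k) (σ := σ) (gateValues P.gates) Q.gates []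
  simpa [gateValues] using this

/-- Auxiliary step of the junk-guard discharge (`gateValues_append_eq`). [folklore] -/
theorem _root_.Literature.Computability.AlgebraicComplexity.ArithCircuit.gateValues_append_eq (P Q : ArithCircuit k σ) :
    gateValues (P.append Q).gates = gateValues P.gates ++ gateValues Q.gates :=
  gateValues_append_holds P Q

/-- Discharge of the in-tree fact `ArithCircuit.eval_add` (interim proof, re-run). -/
theorem _root_.Literature.Computability.AlgebraicComplexity.ArithCircuit.eval_add_holds : @ArithCircuit.eval_add k σ _ := by
  intro P Q
  have hP := gateValues_length (k := k) P.gates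
  have hQ := gateValues_length (k := k) Q.gates
  have h1 := Operand.eval_truncate_append (gateValues P.gates) (gateValues Q.gates) P.output
  have h2 := Operand.eval_shift_append (gateValues P.gates) (gateValues Q.gates) Q.output
  rw [hP] at h1 h2
  simp [ArithCircuit.eval, add, gateValues_append_eq, Gate.eval, size, List.getD_eq_getElem?_getD, hP, hQ,
    h1, h2]

/-- Discharge of the in-tree fact `ArithCircuit.eval_mul` (interim proof, re-run). -/
theorem _root_.Literature.Computability.AlgebraicComplexity.ArithCircuit.eval_mul_holds : @ArithCircuit.eval_mul k σ _ := by
  intro P Q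
  have hP := gateValues_length (k := k) P.gates
  have hQ := gateValues_length (k := k) Q.gates
  have h1 := Operand.eval_truncate_append (gateValues P.gates) (gateValues Q.gates) P.output
  have h2 := Operand.eval_shift_append (gateValues P.gates) (gateValues Q.gates) Q.output
  rw [hP] at h1 h2
  simp [ArithCircuit.eval, mul, gateValues_append_eq, Gate.eval, size, List.getD_eq_getElem?_getD, hP, hQ,
    h1, h2]

omit [CommSemiring k] in
/-- Auxiliary step of the junk-guard discharge (`isFanInTwo_ofConst`). [folklore] -/
theorem _root_.Literature.Computability.AlgebraicComplexity.ArithCircuit.isFanInTwo_ofConst (c : k) : (ofConst c : ArithCircuit k σ).IsFanInTwo := by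
  simp [IsFanInTwo, ofConst]

omit [CommSemiring k] in
/-- Auxiliary step of the junk-guard discharge (`isFanInTwo_ofVar`). [folklore] -/
theorem _root_.Literature.Computability.AlgebraicComplexity.ArithCircuit.isFanInTwo_ofVar (i : σ) : (ofVar i : ArithCircuit k σ).IsFanInTwo := by
  simp [IsFanInTwo, ofVar]

/-- Auxiliary step of the junk-guard discharge (`isFanInTwo_add`). [folklore] -/
theorem _root_.Literature.Computability.AlgebraicComplexity.ArithCircuit.isFanInTwo_add {P Q : ArithCircuit k σ} (hP : P.IsFanInTwo) (hQ : Q.IsFanInTwo) :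
    (P.add Q).IsFanInTwo := by
  intro g hg
  simp only [add, append, List.mem_append, List.mem_map, List.mem_singleton] at hg
  rcases hg with (hg | ⟨g0, hg0, rfl⟩) | rfl
  · exact hP g hg
  · rw [Gate.fanIn_shift]; exact hQ g0 hg0
  · simp [Gate.fanIn, Gate.args]

/-- Auxiliary step of the junk-guard discharge (`isFanInTwo_mul`). [folklore] -/
theorem _root_.Literature.Computability.AlgebraicComplexity.ArithCircuit.isFanInTwo_mul {P Q : ArithCircuit k σ} (hP : P.IsFanInTwo) (hQ : Q.IsFanInTwo) :
    (P.mul Q).IsFanInTwo := by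
  intro g hg
  simp only [mul, append, List.mem_append, List.mem_map, List.mem_singleton] at hg
  rcases hg with (hg | ⟨g0, hg0, rfl⟩) | rfl
  · exact hP g hg
  · rw [Gate.fanIn_shift]; exact hQ g0 hg0
  · simp [Gate.fanIn, Gate.args]

/-- **Junk guard.** Every polynomial is computed by some fan-in-two circuit, so the set
defining `complexity f` is nonempty. -/
theorem _root_.Literature.Computability.AlgebraicComplexity.ArithCircuit.exists_isFanInTwo_computes (f : MvPolynomial σ k) :
    ∃ P : ArithCircuit k σ, P.IsFanInTwo ∧ P.Computes f := by
  induction f using MvPolynomial.induction_on with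
  | C a => exact ⟨ofConst a, isFanInTwo_ofConst a, rfl⟩
  | add p q hp hq =>
    obtain ⟨P, hP1, hP2⟩ := hp
    obtain ⟨Q, hQ1, hQ2⟩ := hq
    refine ⟨P.add Q, isFanInTwo_add hP1 hQ1, ?_⟩
    have := eval_add_holds (k := k) (σ := σ) P Q
    rw [Computes] at hP2 hQ2 ⊢
    rw [this, hP2, hQ2]
  | mul_X p i hp =>
    obtain ⟨P, hP1, hP2⟩ := hp
    refine ⟨P.mul (ofVar i), isFanInTwo_mul hP1 (isFanInTwo_ofVar i), ?_⟩
    have := eval_mul_holds (k := k) (σ := σ) P (ofVar i)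
    rw [Computes] at hP2 ⊢
    rw [this, hP2, eval_ofVar]


/-! ### Well-formedness bookkeeping (to discharge `exists_computes` verbatim) -/

omit [CommSemiring k] in
/-- Auxiliary step of the junk-guard discharge (`Operand.refsBelow_mono`). [folklore] -/
theorem _root_.Literature.Computability.AlgebraicComplexity.ArithCircuit.Operand.refsBelow_mono {m n : ℕ} (h : m ≤ n) {u : Operand k σ} (hu : u.RefsBelow m) :
    u.RefsBelow n := by
  cases u with
  | var i => trivial
  | const c => trivial
  | gate j => exact Nat.lt_of_lt_of_le hu h

omit [CommSemiring k] in
/-- Auxiliary step of the junk-guard discharge (`Operand.refsBelow_shift`). [folklore] -/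
theorem _root_.Literature.Computability.AlgebraicComplexity.ArithCircuit.Operand.refsBelow_shift {m : ℕ} (n : ℕ) {u : Operand k σ} (hu : u.RefsBelow m) :
    (u.shift n).RefsBelow (m + n) := by
  cases u with
  | var i => trivial
  | const c => trivial
  | gate j => exact Nat.add_lt_add_right hu n

omit [CommSemiring k] in
/-- Auxiliary step of the junk-guard discharge (`Operand.refsBelow_truncate`). [folklore] -/
theorem _root_.Literature.Computability.AlgebraicComplexity.ArithCircuit.Operand.refsBelow_truncate [Zero k] (n : ℕ) (u : Operand k σ) :
    (u.truncate n).RefsBelow n := by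
  cases u with
  | var i => trivial
  | const c => trivial
  | gate j =>
    by_cases h : j < n
    · simp only [Operand.truncate, h, if_true]; exact h
    · simp only [Operand.truncate, h, if_false]; trivial

omit [CommSemiring k] in
/-- Auxiliary step of the junk-guard discharge (`Gate.args_shift`). [folklore] -/
theorem _root_.Literature.Computability.AlgebraicComplexity.ArithCircuit.Gate.args_shift (n : ℕ) (g : Gate k σ) : (g.shift n).args = g.args.map (Operand.shift n) := by
  cases g <;> simp [Gate.shift, Gate.args, List.map_map, Function.comp_def]

omit [CommSemiring k] in
/-- Auxiliary step of the junk-guard discharge (`wellFormed_ofConst`). [folklore] -/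
theorem _root_.Literature.Computability.AlgebraicComplexity.ArithCircuit.wellFormed_ofConst (c : k) : (ofConst c : ArithCircuit k σ).WellFormed :=
  ⟨fun i g h => by simp [ofConst] at h, trivial⟩

omit [CommSemiring k] in
/-- Auxiliary step of the junk-guard discharge (`wellFormed_ofVar`). [folklore] -/
theorem _root_.Literature.Computability.AlgebraicComplexity.ArithCircuit.wellFormed_ofVar (i : σ) : (ofVar i : ArithCircuit k σ).WellFormed :=
  ⟨fun i g h => by simp [ofVar] at h, trivial⟩

omit [CommSemiring k] in
/-- Well-formedness of the generic binary combinator behind `add`/`mul`. -/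
theorem _root_.Literature.Computability.AlgebraicComplexity.ArithCircuit.wellFormed_binop [Zero k] {P Q : ArithCircuit k σ} (hP : P.WellFormed) (hQ : Q.WellFormed)
    (g3 : Gate k σ) (hg3 : g3.args = [P.output.truncate P.size, Q.output.shift P.size]) :
    (⟨(P.append Q).gates ++ [g3], .gate (P.size + Q.size)⟩ : ArithCircuit k σ).WellFormed := by
  have hlen : (P.append Q).gates.length = P.size + Q.size := size_append P Q
  refine ⟨?_, ?_⟩
  · intro i g hg u hu
    by_cases hi : i < (P.append Q).gates.length
    · rw [List.getElem?_append_left hi] at hg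
      -- inside `P.append Q`
      simp only [append] at hg hi
      by_cases hiP : i < P.gates.length
      · rw [List.getElem?_append_left hiP] at hg
        exact hP.1 i g hg u hu
      · push Not at hiP
        rw [List.getElem?_append_right hiP, List.getElem?_map] at hg
        obtain ⟨g0, hg0, rfl⟩ := Option.map_eq_some_iff.1 hg
        rw [Gate.args_shift, List.mem_map] at hu
        obtain ⟨u0, hu0, rfl⟩ := hu
        have h0 := hQ.1 _ g0 hg0 u0 hu0
        have := Operand.refsBelow_shift P.size h0
        have hsz : P.size = P.gates.length := rfl
        exact Operand.refsBelow_mono (by omega) this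
    · push Not at hi
      rw [List.getElem?_append_right hi] at hg
      have hi0 : i - (P.append Q).gates.length = 0 := by
        rcases Nat.eq_zero_or_pos (i - (P.append Q).gates.length) with h | h
        · exact h
        · rw [List.getElem?_eq_none_iff.2 (by simp; omega)] at hg
          exact absurd hg (by simp)
      rw [hi0] at hg
      simp only [List.getElem?_cons_zero, Option.some.injEq] at hg
      subst hg
      have hieq : i = P.size + Q.size := by omega
      rw [hg3] at hu
      simp only [List.mem_cons, List.not_mem_nil, or_false] at hu
      rcases hu with rfl | rfl
      · exact Operand.refsBelow_mono (by omega) (Operand.refsBelow_truncate P.size P.output)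
      · have := Operand.refsBelow_shift P.size hQ.2
        exact Operand.refsBelow_mono (by omega) this
  · show P.size + Q.size < (List.length _)
    simp [hlen]

/-- Auxiliary step of the junk-guard discharge (`wellFormed_add`). [folklore] -/
theorem _root_.Literature.Computability.AlgebraicComplexity.ArithCircuit.wellFormed_add {P Q : ArithCircuit k σ} (hP : P.WellFormed) (hQ : Q.WellFormed) :
    (P.add Q).WellFormed :=
  wellFormed_binop hP hQ _ (by simp [Gate.args])

omit [CommSemiring k] in
/-- Auxiliary step of the junk-guard discharge (`wellFormed_mul`). [folklore] -/
theorem _root_.Literature.Computability.AlgebraicComplexity.ArithCircuit.wellFormed_mul [Zero k] {P Q : ArithCircuit k σ} (hP : P.WellFormed) (hQ : Q.WellFormed) :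
    (P.mul Q).WellFormed :=
  wellFormed_binop hP hQ _ rfl

/-- **Discharge of the in-tree fact `ArithCircuit.exists_computes`** (item
stmt-ValiantsHypothesis-0546 / `StatementJunkGuard.ArithCircuitExistsComputesProved`, universe
polymorphic): every polynomial is computed by a well-formed fan-in-two circuit. -/
theorem _root_.Literature.Computability.AlgebraicComplexity.ArithCircuit.exists_computes_holds : @exists_computes k σ _ := by
  intro f
  induction f using MvPolynomial.induction_on with
  | C a => exact ⟨ofConst a, isFanInTwo_ofConst a, wellFormed_ofConst a, rfl⟩
  | add p q hp hq =>
    obtain ⟨P, hP1, hPw, hP2⟩ := hp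
    obtain ⟨Q, hQ1, hQw, hQ2⟩ := hq
    refine ⟨P.add Q, isFanInTwo_add hP1 hQ1, wellFormed_add hPw hQw, ?_⟩
    have := eval_add_holds (k := k) (σ := σ) P Q
    rw [Computes] at hP2 hQ2 ⊢
    rw [this, hP2, hQ2]
  | mul_X p i hp =>
    obtain ⟨P, hP1, hPw, hP2⟩ := hp
    refine ⟨P.mul (ofVar i), isFanInTwo_mul hP1 (isFanInTwo_ofVar i),
      wellFormed_mul hPw (wellFormed_ofVar i), ?_⟩
    have := eval_mul_holds (k := k) (σ := σ) P (ofVar i)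
    rw [Computes] at hP2 ⊢
    rw [this, hP2, eval_ofVar]

/-- The set defining `complexity f` is nonempty … -/
theorem _root_.Literature.Computability.AlgebraicComplexity.ArithCircuit.complexity_set_nonempty (f : MvPolynomial σ k) :
    {s | ∃ P : ArithCircuit k σ, P.IsFanInTwo ∧ P.Computes f ∧ P.size = s}.Nonempty := by
  obtain ⟨P, h1, h2⟩ := exists_isFanInTwo_computes f
  exact ⟨P.size, P, h1, h2, rfl⟩

/-- … hence `complexity f` is attained by an actual circuit (no `sInf ∅` junk). -/
theorem _root_.Literature.Computability.AlgebraicComplexity.ArithCircuit.complexity_attained (f : MvPolynomial σ k) :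
    ∃ P : ArithCircuit k σ, P.IsFanInTwo ∧ P.Computes f ∧ P.size = Literature.Computability.AlgebraicComplexity.complexity f :=
  Nat.sInf_mem (complexity_set_nonempty f)

/-! ### Renaming (for `complexity_rename_le` and `VP ⊆ VNP`) -/

omit [CommSemiring k] in
/-- Auxiliary step of the junk-guard discharge (`Gate.fanIn_rename`). [folklore] -/
theorem _root_.Literature.Computability.AlgebraicComplexity.ArithCircuit.Gate.fanIn_rename {τ : Type*} (e : σ → τ) (g : Gate k σ) : (g.rename e).fanIn = g.fanIn := by
  cases g <;> simp [Gate.rename, Gate.fanIn, Gate.args]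

/-- Auxiliary step of the junk-guard discharge (`Operand.eval_rename`). [folklore] -/
theorem _root_.Literature.Computability.AlgebraicComplexity.ArithCircuit.Operand.eval_rename {τ : Type*} (e : σ → τ) (vals : List (MvPolynomial σ k)) (u : Operand k σ) :
    (u.rename e).eval (vals.map (MvPolynomial.rename e)) = MvPolynomial.rename e (u.eval vals) := by
  cases u with
  | var i => simp [Operand.rename, Operand.eval]
  | const c => simp [Operand.rename, Operand.eval]
  | gate j =>
    simp only [Operand.rename, Operand.eval]
    simp only [List.getD_eq_getElem?_getD, List.getElem?_map]
    cases vals[j]? <;> simp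

/-- Auxiliary step of the junk-guard discharge (`Gate.eval_rename`). [folklore] -/
theorem _root_.Literature.Computability.AlgebraicComplexity.ArithCircuit.Gate.eval_rename {τ : Type*} (e : σ → τ) (vals : List (MvPolynomial σ k)) (g : Gate k σ) :
    (g.rename e).eval (vals.map (MvPolynomial.rename e)) = MvPolynomial.rename e (g.eval vals) := by
  cases g with
  | sum args =>
    simp [Gate.rename, Gate.eval, List.map_map, Function.comp_def, Operand.eval_rename, map_list_sum]
  | prod args =>
    simp [Gate.rename, Gate.eval, List.map_map, Function.comp_def, Operand.eval_rename, map_list_prod]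

/-- Auxiliary step of the junk-guard discharge (`gateValues_rename`). [folklore] -/
theorem _root_.Literature.Computability.AlgebraicComplexity.ArithCircuit.gateValues_rename {τ : Type*} (e : σ → τ) (gs : List (Gate k σ)) :
    gateValues (gs.map (Gate.rename e)) = (gateValues gs).map (MvPolynomial.rename e) := by
  induction gs using List.reverseRecOn with
  | nil => rfl
  | append_singleton gs g ih =>
    rw [List.map_append, List.map_singleton, gateValues_append_singleton,
      gateValues_append_singleton, ih, Gate.eval_rename]
    simp

/-- Discharge of the in-tree fact `ArithCircuit.eval_rename`. -/
theorem _root_.Literature.Computability.AlgebraicComplexity.ArithCircuit.eval_rename_holds {τ : Type*} (e : σ → τ) (P : ArithCircuit k σ) :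
    (P.rename e).eval = MvPolynomial.rename e P.eval := by
  simp only [ArithCircuit.eval, ArithCircuit.rename, gateValues_rename, Operand.eval_rename]

end ArithCircuit

section

universe u' v' w'
variable {k : Type u'} {σ : Type v'} {τ : Type w'} [CommSemiring k]

/-- Discharge of the in-tree fact `complexity_rename_le` (uses attainment of `complexity`). -/
theorem complexity_rename_le_holds (e : σ → τ) (f : MvPolynomial σ k) :
    Literature.Computability.AlgebraicComplexity.complexity (MvPolynomial.rename e f) ≤ Literature.Computability.AlgebraicComplexity.complexity f := by
  obtain ⟨P, h1, h2, h3⟩ := Literature.Computability.AlgebraicComplexity.ArithCircuit.complexity_attained f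
  rw [← h3]
  apply Nat.sInf_le
  refine ⟨P.rename e, ?_, ?_, Literature.Computability.AlgebraicComplexity.ArithCircuit.size_rename e P⟩
  · intro g hg
    simp only [Literature.Computability.AlgebraicComplexity.ArithCircuit.rename, List.mem_map] at hg
    obtain ⟨g0, hg0, rfl⟩ := hg
    rw [Literature.Computability.AlgebraicComplexity.ArithCircuit.Gate.fanIn_rename]; exact h1 g0 hg0
  · rw [Literature.Computability.AlgebraicComplexity.ArithCircuit.Computes, Literature.Computability.AlgebraicComplexity.ArithCircuit.eval_rename_holds, h2]

variable {ι : ℕ → Type v'} [∀ n, Fintype (ι n)]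

/-- Discharge of the in-tree fact `IsVPFamily.isVNPFamily`: `VP ⊆ VNP` for predicates
(empty Boolean sum, `u = 0`, `gₙ = rename inl fₙ`). -/
theorem _root_.Literature.Computability.AlgebraicComplexity.IsVPFamily.isVNPFamily_holds {f : ∀ n, MvPolynomial (ι n) k} (hf : Literature.Computability.AlgebraicComplexity.IsVPFamily f) :
    Literature.Computability.AlgebraicComplexity.IsVNPFamily f := by
  refine ⟨hf.1, fun _ => 0, fun n => MvPolynomial.rename Sum.inl (f n), ⟨⟨?_, ?_⟩, ?_⟩, fun n => ?_⟩
  · obtain ⟨c, hc⟩ := hf.1.1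
    exact ⟨c, fun n => by simpa [Fintype.card_sum] using hc n⟩
  · exact hf.1.2.mono fun n => MvPolynomial.totalDegree_rename_le _ _
  · exact hf.2.mono fun n => complexity_rename_le_holds _ _
  · simp only [Literature.Computability.AlgebraicComplexity.boolSum, MvPolynomial.aeval_rename]
    rw [Fintype.sum_unique]
    exact (MvPolynomial.aeval_X_left_apply (f n)).symm

/-- Discharge of the in-tree fact `VP_subset_VNP k`. -/
theorem VP_subset_VNP_holds (k : Type u') [CommSemiring k] : Literature.Computability.AlgebraicComplexity.VP_subset_VNP k :=
  fun _ hF => Literature.Computability.AlgebraicComplexity.IsVPFamily.isVNPFamily_holds hF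

end

end Literature.CplxAlg



namespace Summit.ValiantsHypothesis.JunkGuard

/-- Discharge of `StatementJunkGuard.ArithCircuitExistsComputesProved` (item
stmt-ValiantsHypothesis-0546): every polynomial is computed by a well-formed fan-in-two circuit,
so `Literature.Computability.AlgebraicComplexity.complexity` is never the junk `sInf ∅`. [folklore] -/
theorem arithCircuitExistsComputesProved :
    Summit.ValiantsHypothesis.ValiantsHypothesis.Theses.StatementJunkGuard.ArithCircuitExistsComputesProved :=
  fun k _ σ => Literature.Computability.AlgebraicComplexity.ArithCircuit.exists_computes_holds (k := k) (σ := σ)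

/-- `VP ℂ ⊆ VNP ℂ`, hence the summit `VP ℂ ≠ VNP ℂ` is literally `VNP ℂ ⊄ VP ℂ`
(Bürgisser 2000: "Valiant's hypothesis claims that this inclusion is strict"). [folklore] -/
theorem valiantsHypothesis_iff_not_subset :
    ValiantsHypothesis ↔ ¬ (Literature.Computability.AlgebraicComplexity.VNP ℂ ⊆ Literature.Computability.AlgebraicComplexity.VP ℂ) := by
  have hsub : Literature.Computability.AlgebraicComplexity.VP ℂ ⊆ Literature.Computability.AlgebraicComplexity.VNP ℂ := Literature.CplxAlg.VP_subset_VNP_holds ℂ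
  show Literature.Computability.AlgebraicComplexity.VP ℂ ≠ Literature.Computability.AlgebraicComplexity.VNP ℂ ↔ _
  constructor
  · exact fun hne h => hne (Set.Subset.antisymm hsub h)
  · exact fun h hEq => h (hEq ▸ le_rfl)

end Summit.ValiantsHypothesis.JunkGuard
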